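import Mathlib
import Literature.Computability.AlgebraicComplexity.AsymptoticSpectrum
import Literature.Computability.AlgebraicComplexity.AsymptoticSpectrumDuality
import Literature.Computability.AlgebraicComplexity.QuantumFunctionals

-- (imports Literature only: the piece is copied verbatim below, so this file elaborates independently of the
-- route file's revision; the route decl `HesseHammingShells.<Piece>` unfolds to the local copy.)

/-!
# Birth skeleton for the crux `SignedTableARC` (stmt-MatrixMultiplication-17613) — line "spectral flatness at the signed table"

`SignedTableARC`: `R̃(T_{-1}) ≤ 3` for the signed `Z_3` addition table
`T_{-1}(x,y,z) = [x+y+z=0]·(−1)^{[x≠y]}` (Hesse-pencil member `s = −1`; with the unit points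
`s ∈ {0} ∪ μ₃` free, `−1 ∈ μ₆ ∖ μ₃` is the CANONICAL next point: by the generating identity
`T_s^{⊠N} = Σ_m s^m H_m^{(N)}` and `T_{ωs} ≅ T_s`, ARC at `T_{-1}` is exactly "the Hamming shells
grouped by radius mod 6 have rate 3", one step beyond the free radius-mod-3 theorem
`ClassRankBound`).

Line. By Strassen duality (PROVED in tree: `strassen_duality_asymptoticRank_holds`, CVZ Prop. 1.6)
`R̃(t) = max_F F(t)` over universal spectral points, so the crux says: NO universal spectral point
exceeds `3` at `T_{-1}`. The catalogued points are blind there: every quantum functional equals `3`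
at `T_{-1}` (`stub_signedQuantumValue` — its three one-body marginals are flat, each slice being a
signed permutation matrix, so the quantum entropy at the identity is already `log₂ 3`, and
`E_θ ≤ log₂ 3` by the dimension bound `logQuantumFunctional_le`; provable now from the CVZ lemmas in
`QuantumFunctionals.lean`). The content is `stub_signedSpectralDominated`: at `T_{-1}` every
universal spectral point is dominated by some quantum functional — the Christandl–Vrana–Zuiddam
completeness question asked at ONE free tensor with entries `0, ±1` and flat moment data (a "dark
point" at `T_{-1}` refutes it and the crux, and touches neither `cw₂` nor `ω`). Composition
`SignedTableARC_of` (kernel-checked; sorries only in the two stubs).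
-/

set_option linter.dupNamespace false

namespace Summit.MatrixMultiplication.MatrixMultiplication.Cruxes.SignedTableARC.SpectralFlatness

open Literature.Computability.AlgebraicComplexity

/-- The crux, verbatim (the route decl `HesseHammingShells.SignedTableARC` unfolds to this). -/
def SignedTableARC : Prop :=
  Literature.Computability.AlgebraicComplexity.asymptoticRank (fun x y z : Fin 3 => if x + y + z = 0 then (if x = y then (1 : ℂ) else (-1 : ℂ)) else 0) ≤ 3

/-- STUB 1 (provable-now, size M): every quantum functional takes the value `3` at the signed table
(flat marginals + dimension bound; only `≤` is used below). -/
theorem stub_signedQuantumValue :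
    ∀ θ : Fin 3 → ℝ, θ ∈ stdSimplex ℝ (Fin 3) →
      quantumFunctional θ (fun x y z : Fin 3 => if x + y + z = 0 then (if x = y then (1 : ℂ) else (-1 : ℂ)) else 0) = 3 := by
  sorry

/-- STUB 2 (the content, size XL): at the signed table the quantum functionals are spectrally
complete from above — every universal spectral point is dominated there by a quantum functional. -/
theorem stub_signedSpectralDominated :
    ∀ F : SpectralMap ℂ, IsUniversalSpectralPoint ℂ F →
      ∃ θ : Fin 3 → ℝ, θ ∈ stdSimplex ℝ (Fin 3) ∧
        F (fun x y z : Fin 3 => if x + y + z = 0 then (if x = y then (1 : ℂ) else (-1 : ℂ)) else 0) ≤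
          quantumFunctional θ (fun x y z : Fin 3 => if x + y + z = 0 then (if x = y then (1 : ℂ) else (-1 : ℂ)) else 0) := by
  sorry

/-- COMPOSITION (kernel-checked): domination by quantum functionals + their value `3` + Strassen
duality (proved) give `R̃(T_{-1}) ≤ 3`. -/
theorem SignedTableARC_of
    (h₁ : ∀ θ : Fin 3 → ℝ, θ ∈ stdSimplex ℝ (Fin 3) →
      quantumFunctional θ (fun x y z : Fin 3 => if x + y + z = 0 then (if x = y then (1 : ℂ) else (-1 : ℂ)) else 0) = 3)
    (h₂ : ∀ F : SpectralMap ℂ, IsUniversalSpectralPoint ℂ F →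
      ∃ θ : Fin 3 → ℝ, θ ∈ stdSimplex ℝ (Fin 3) ∧
        F (fun x y z : Fin 3 => if x + y + z = 0 then (if x = y then (1 : ℂ) else (-1 : ℂ)) else 0) ≤
          quantumFunctional θ (fun x y z : Fin 3 => if x + y + z = 0 then (if x = y then (1 : ℂ) else (-1 : ℂ)) else 0)) :
    SignedTableARC := by
  refine strassen_duality_asymptoticRank.asymptoticRank_le (strassen_duality_asymptoticRank_holds ℂ) _
    fun F hUF => ?_
  obtain ⟨θ, hθ, hle⟩ := h₂ F hUF
  exact hle.trans (h₁ θ hθ).le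

/-- The skeleton closes the crux from its stubs. -/
theorem SignedTableARC_of_stubs : SignedTableARC :=
  SignedTableARC_of stub_signedQuantumValue stub_signedSpectralDominated

end Summit.MatrixMultiplication.MatrixMultiplication.Cruxes.SignedTableARC.SpectralFlatness
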